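import Mathlib

/-!
# Counting supersets among `k`-subsets; binomial ratios (anchored-theta refutation, part B)

Part of the refutation of `stub_convReplaceable` (line `width-threshold-certificate-sparsity` of
crux stmt-PneNP-10682, `ConvexRankGates.CliqueExtLowerBound`) by the ANCHORED THETA GATE; the final
theorem is `stub_convReplaceable_false` in `ConvReplaceableFalse.lean`, whose module docstring has the
overview. Witness: at `c = 3`, for every `a`, localities `r = 3, s = 4`, at every large `m = n + 2`, the
theta programme on the `n+1` non-anchor vertices with clique parameter `k-1` (`k = ⌈m^{1/4}⌉₊`), fed
with children `d_j = {{e₀, p_j}}`, `c_j = {{e₀, f(α,γ), f(β,γ)} : γ < h}`, is not replaceable by any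
monotone circuit of size `m^a`: Jukna's criterion on the derived coordinates kills both exits.
-/

set_option linter.dupNamespace false

namespace Summit.PneNP.PneNP.Theorems.CliqueExtLowerBound.Negative

open Finset

noncomputable section

/-! ## B. Counting: supersets of a fixed set among the `k`-subsets, binomial ratios -/

section Counting

variable {α : Type*} [Fintype α] [DecidableEq α]

/-- The `k`-subsets containing `S` and avoiding `F` are in bijection with the `(k - #S)`-subsets of
the complement of `S ∪ F`. [folklore] -/
theorem card_filter_supset_disjoint (S F : Finset α) (hSF : Disjoint S F) (k : ℕ) (hk : #S ≤ k) :
    #(((univ : Finset α).powersetCard k).filter fun K => S ⊆ K ∧ Disjoint F K) =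
      (Fintype.card α - (#S + #F)).choose (k - #S) := by
  have hc : #(((univ : Finset α) \ (S ∪ F)).powersetCard (k - #S)) =
      (Fintype.card α - (#S + #F)).choose (k - #S) := by
    rw [card_powersetCard, card_univ_sdiff, card_union_of_disjoint hSF]
  rw [← hc]
  refine card_bij' (fun K _ => K \ S) (fun T _ => T ∪ S) ?_ ?_ ?_ ?_
  · intro K hK
    rw [mem_filter, mem_powersetCard] at hK
    obtain ⟨⟨-, hKk⟩, hSK, hFK⟩ := hK
    rw [mem_powersetCard]
    refine ⟨fun x hx => ?_, ?_⟩
    · rw [Finset.mem_sdiff] at hx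
      rw [Finset.mem_sdiff, mem_union, not_or]
      exact ⟨mem_univ _, hx.2, fun hxF => (disjoint_left.1 hFK hxF) hx.1⟩
    · rw [card_sdiff_of_subset hSK, hKk]
  · intro T hT
    rw [mem_powersetCard] at hT
    obtain ⟨hTsub, hTk⟩ := hT
    have hTS : Disjoint T S := disjoint_left.2 fun x hxT hxS => by
      have := hTsub hxT
      rw [Finset.mem_sdiff, mem_union, not_or] at this
      exact this.2.1 hxS
    have hTF : Disjoint F T := disjoint_left.2 fun x hxF hxT => by
      have := hTsub hxT
      rw [Finset.mem_sdiff, mem_union, not_or] at this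
      exact this.2.2 hxF
    rw [mem_filter, mem_powersetCard]
    refine ⟨⟨subset_univ _, ?_⟩, subset_union_right, ?_⟩
    · rw [card_union_of_disjoint hTS, hTk]
      omega
    · exact disjoint_union_right.2 ⟨hTF, hSF.symm⟩
  · intro K hK
    rw [mem_filter] at hK
    exact sdiff_union_of_subset hK.2.1
  · intro T hT
    rw [mem_powersetCard] at hT
    have hTS : Disjoint T S := disjoint_left.2 fun x hxT hxS => by
      have := hT.1 hxT
      rw [Finset.mem_sdiff, mem_union, not_or] at this
      exact this.2.1 hxS
    exact union_sdiff_cancel_right hTS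

/-- The `k`-subsets containing `S`. [folklore] -/
theorem card_filter_supset (S : Finset α) (k : ℕ) (hk : #S ≤ k) :
    #(((univ : Finset α).powersetCard k).filter fun K => S ⊆ K) =
      (Fintype.card α - #S).choose (k - #S) := by
  have h := card_filter_supset_disjoint S ∅ (disjoint_empty_right S) k hk
  rw [card_empty, add_zero] at h
  rw [← h]
  congr 1
  exact filter_congr fun K _ => by simp

/-- Fewer required elements, more supersets. [folklore] -/
theorem card_filter_supset_mono {S S' : Finset α} (h : S' ⊆ S) (k : ℕ) :
    #(((univ : Finset α).powersetCard k).filter fun K => S ⊆ K) ≤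
      #(((univ : Finset α).powersetCard k).filter fun K => S' ⊆ K) :=
  card_le_card (fun K hK => by
    rw [mem_filter] at hK ⊢
    exact ⟨hK.1, h.trans hK.2⟩)

end Counting

/-! ### Binomial ratio inequalities (cross-multiplied, in `ℕ`) -/

/-- `C(n-j, r-j) · n^j ≤ C(n, r) · r^j` for `j ≤ r ≤ n` (the fraction of `r`-sets containing `j` fixed
points is at most `(r/n)^j`). [folklore] -/
theorem choose_sub_sub_mul_pow_le (n r : ℕ) (hr : r ≤ n) :
    ∀ j : ℕ, j ≤ r → (n - j).choose (r - j) * n ^ j ≤ n.choose r * r ^ j := by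
  intro j
  induction j with
  | zero => intro; simp
  | succ j ih =>
    intro hj
    have hj' : j < r := hj
    have key : (n - (j + 1)).choose (r - (j + 1)) * n ≤ (n - j).choose (r - j) * r := by
      have hid := Nat.add_one_mul_choose_eq (n - j - 1) (r - j - 1)
      have h1 : n - j - 1 + 1 = n - j := by omega
      have h2 : r - j - 1 + 1 = r - j := by omega
      rw [h1, h2] at hid
      -- hid : (n - j) * C(n-j-1, r-j-1) = C(n-j, r-j) * (r - j)
      have hpos : 0 < n - j := by omega
      refine Nat.le_of_mul_le_mul_right ?_ hpos
      have e1 : (n - (j + 1)).choose (r - (j + 1)) * n * (n - j) =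
          n * ((n - j) * (n - j - 1).choose (r - j - 1)) := by
        rw [show n - (j + 1) = n - j - 1 by omega, show r - (j + 1) = r - j - 1 by omega]; ring
      rw [e1, hid]
      have hineq : n * (r - j) ≤ r * (n - j) := by
        zify [hj'.le, (hj'.le.trans hr)]
        nlinarith
      calc n * ((n - j).choose (r - j) * (r - j)) = (n - j).choose (r - j) * (n * (r - j)) := by ring
        _ ≤ (n - j).choose (r - j) * (r * (n - j)) := Nat.mul_le_mul_left _ hineq
        _ = (n - j).choose (r - j) * r * (n - j) := by ring
    calc (n - (j + 1)).choose (r - (j + 1)) * n ^ (j + 1)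
        = (n - (j + 1)).choose (r - (j + 1)) * n * n ^ j := by ring
      _ ≤ (n - j).choose (r - j) * r * n ^ j := Nat.mul_le_mul_right _ key
      _ = (n - j).choose (r - j) * n ^ j * r := by ring
      _ ≤ n.choose r * r ^ j * r := Nat.mul_le_mul_right _ (ih hj'.le)
      _ = n.choose r * r ^ (j + 1) := by ring

/-- `C(n-j, r) · n^j ≤ C(n, r) · (n-r)^j` for `j ≤ n` (the fraction of `r`-sets avoiding `j` fixed points
is at most `((n-r)/n)^j`). [folklore] -/
theorem choose_sub_mul_pow_le (n r : ℕ) :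
    ∀ j : ℕ, j ≤ n → (n - j).choose r * n ^ j ≤ n.choose r * (n - r) ^ j := by
  intro j
  induction j with
  | zero => intro; simp
  | succ j ih =>
    intro hj
    have hj' : j < n := hj
    have key : (n - (j + 1)).choose r * n ≤ (n - j).choose r * (n - r) := by
      have hid := Nat.choose_mul_succ_eq (n - j - 1) r
      have h1 : n - j - 1 + 1 = n - j := by omega
      rw [h1] at hid
      -- hid : C(n-j-1, r) * (n - j) = C(n-j, r) * (n - j - r)
      have hpos : 0 < n - j := by omega
      refine Nat.le_of_mul_le_mul_right ?_ hpos
      have e1 : (n - (j + 1)).choose r * n * (n - j) = n * ((n - j - 1).choose r * (n - j)) := by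
        rw [show n - (j + 1) = n - j - 1 by omega]; ring
      rw [e1, hid]
      have hineq : n * (n - j - r) ≤ (n - r) * (n - j) := by
        rcases le_or_gt (j + r) n with hle | hlt
        · zify [hle, hj'.le, (show r ≤ n by omega), (show r ≤ n - j by omega)]
          have hr0 : (0 : ℤ) ≤ r := by positivity
          have hj0 : (0 : ℤ) ≤ j := by positivity
          nlinarith
        · rw [show n - j - r = 0 by omega]; simp
      calc n * ((n - j).choose r * (n - j - r)) = (n - j).choose r * (n * (n - j - r)) := by ring
        _ ≤ (n - j).choose r * ((n - r) * (n - j)) := Nat.mul_le_mul_left _ hineq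
        _ = (n - j).choose r * (n - r) * (n - j) := by ring
    calc (n - (j + 1)).choose r * n ^ (j + 1) = (n - (j + 1)).choose r * n * n ^ j := by ring
      _ ≤ (n - j).choose r * (n - r) * n ^ j := Nat.mul_le_mul_right _ key
      _ = (n - j).choose r * n ^ j * (n - r) := by ring
      _ ≤ n.choose r * (n - r) ^ j * (n - r) := Nat.mul_le_mul_right _ (ih hj'.le)
      _ = n.choose r * (n - r) ^ (j + 1) := by ring

end

end Summit.PneNP.PneNP.Theorems.CliqueExtLowerBound.Negative
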